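import Summits.CriticalPhenomena.PercolationContinuityZ3.Theorems.PercNearOneGluingNoHeavyLowerTailMajorityGluingSix
import Summits.CriticalPhenomena.PercolationContinuityZ3.Theorems.PercNearOneGluingNoHeavyLowerTailMajorityGluingHubOnlyWeak
import HarnessLib

/-!
# Majority gluing at `|A| = 6`: loss `2·max` in the whole regime `max ≥ 13/256` (van den Berg–Kahn + Harris)
# (lane prim-rate, constants-miner 1, gen 3 — row M1-V6δ; the first cell of the open window `6 ≤ |A| ≤ 55`)

Support file for the closed crux `NoHeavyLowerTail` (stmt-CriticalPhenomena-4575; `--supports … --as helper`), continuing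
`…MajorityGluingSix.lean` (p315087: `C(6) ≤ 499/243`, UNION bound `μ(H_a) ≤ μ(c ↮ a₀) + μ(≥ 3 of 4 cut)`) and
`…MajorityGluingHubOnlyWeak.lean` (p312163: Harris for `{c ↔ a₀} ∩ {threshold cut}`).

Inserting Harris (increasing × decreasing) into the `|A| = 6` assembly gives, at non-degenerate weights and with `M = max_{a∈A} μ(a ↮ a₀)`,
`μ(H_a) ≤ δ_c + (1 − δ_c)·μ(≥ 3 of A ∖ {a₀,c} cut) ≤ M + (1 − M)·min(1, (256/243)·M)` (`hubEvent_card_six_harris`; the second factor is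
`HubOnly.threeOfFour_count`, van den Berg–Kahn log-supermodularity), hence for every weight function, observer and `δ₀ ≥ max` with
`δ₀ ≤ 243/256` (closure over degenerate weights, `weights_le_of_forall_pos_lt_one`, and monotonicity of `t ↦ t + (256/243)t(1−t)` there):
  `μ(o ↔ A) − μ(o ↔ a₀ ∧ 2N > 6) ≤ δ₀ + (256/243)·δ₀·(1 − δ₀)`   (`majorityGluing_card_six_harris`),
a strict improvement of p315087's `(499/243)·δ₀` for every `δ₀ > 0`, and in particular
  **loss `≤ 2·δ₀` at `|A| = 6` whenever `δ₀ ≥ 13/256 ≈ 0.0508`**   (`majorityGluing_two_card_six_of_ge`; for `δ₀ > 1/2` trivially).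
So «`C(6) = 2`» (⟺ the weak percolation-EKR bound at the size `(4,3)`, `…HubOnlyWeakAt.lean`) is OPEN ONLY in the small-marginal regime
`max < 13/256`, exactly where the abstract extremiser of the vdBK relaxation (rare trigger × independent `8/9`-cuts, `…SixAbstract.lean`) lives.
No definitions, no named facts, no sorries. [cite: VandenbergKahn2001, Thm 1.2 (p. 123)] [cite: KozmaNitzan2024, Conj. 1 (p. 3)]
-/

noncomputable section

namespace Summit.CriticalPhenomena.PercolationContinuityZ3.Theorems

open MeasureTheory Set
open Literature.Probability.LatticeModels (prodBernoulli prodBernoulli_real_continuous weights_le_of_forall_pos_lt_one)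
open Literature.Probability.Percolation
open scoped Classical

namespace HubOnly

variable {n : ℕ}

/-- **Hub event at `|A| = 6`, non-degenerate weights, with Harris:** `μ(H_a) ≤ M + (1 − M)·min(1, (256/243)·M)`,
`M = max_{a'∈A} μ(a' ↮ a₀)`.  [cite: VandenbergKahn2001, Thm 1.2 (p. 123)] -/
theorem hubEvent_card_six_harris (p : Sym2 (Fin n) → unitInterval) (A : Finset (Fin n)) (a₀ a : Fin n)
    (ha₀ : a₀ ∈ A) (ha : a ∈ A) (hA : A.card = 6) :
    (prodBernoulli p).real {ω : BondConfig (Fin n) | ω ∈ openConn a a₀ →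
        2 * (A.filter fun a' => ω ∈ openConn a' a₀).card ≤ A.card}
      ≤ A.sup' ⟨a₀, ha₀⟩ (fun a' => (prodBernoulli p).real (openConn a' a₀ : Set (BondConfig (Fin n)))ᶜ) +
        (1 - A.sup' ⟨a₀, ha₀⟩ (fun a' => (prodBernoulli p).real (openConn a' a₀ : Set (BondConfig (Fin n)))ᶜ)) *
          min 1 (256 / 243 * A.sup' ⟨a₀, ha₀⟩ (fun a' => (prodBernoulli p).real (openConn a' a₀ : Set (BondConfig (Fin n)))ᶜ)) := by
  set μ := prodBernoulli p with hμ
  have hms : ∀ S : Set (BondConfig (Fin n)), MeasurableSet S := fun _ => MeasurableSet.of_discrete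
  set δ : Fin n → ℝ := fun x => μ.real (openConn x a₀ : Set (BondConfig (Fin n)))ᶜ with hδ
  set M := A.sup' ⟨a₀, ha₀⟩ δ with hM
  have hδle : ∀ x ∈ A, δ x ≤ M := fun x hx => Finset.le_sup' δ hx
  have hM0 : 0 ≤ M := le_trans measureReal_nonneg (hδle a₀ ha₀)
  -- the auxiliary relay `c ≠ a₀`
  obtain ⟨c, hcA, hca₀, hca⟩ : ∃ c ∈ A, c ≠ a₀ ∧ (a ≠ a₀ → c = a) := by
    by_cases haa : a = a₀
    · have hpos : 1 < A.card := by rw [hA]; norm_num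
      obtain ⟨c, hc, hne⟩ := Finset.exists_mem_ne hpos a₀
      exact ⟨c, hc, hne, fun h => (h haa).elim⟩
    · exact ⟨a, ha, haa, fun _ => rfl⟩
  set T : Finset (Fin n) := (A.erase a₀).erase c with hT
  have hcT : c ∈ A.erase a₀ := Finset.mem_erase.2 ⟨hca₀, hcA⟩
  have hTcard : T.card = 4 := by
    rw [hT, Finset.card_erase_of_mem hcT, Finset.card_erase_of_mem ha₀, hA]
  have hTA : T ⊆ A := (Finset.erase_subset _ _).trans (Finset.erase_subset _ _)
  set K : Set (BondConfig (Fin n)) := {ω | 3 ≤ (T.filter fun v => ω ∉ openConn v a₀).card} with hK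
  -- `H_a ⊆ {c ↮ a₀} ∪ ({c ↔ a₀} ∩ K)`
  have hsub : {ω : BondConfig (Fin n) | ω ∈ openConn a a₀ → 2 * (A.filter fun a' => ω ∈ openConn a' a₀).card ≤ A.card} ⊆
      (openConn c a₀ : Set (BondConfig (Fin n)))ᶜ ∪ ((openConn c a₀ : Set (BondConfig (Fin n))) ∩ K) := by
    intro ω hω
    by_cases hcc : ω ∈ openConn c a₀
    · right
      refine ⟨hcc, ?_⟩
      have haa : ω ∈ openConn a a₀ := by
        by_cases h' : a = a₀
        · rw [h']; exact (SimpleGraph.Reachable.refl _ : (openGraph ω).Reachable a₀ a₀)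
        · rw [← hca h']; exact hcc
      have hle := hω haa
      rw [hA] at hle
      have hsplit := Finset.card_filter_add_card_filter_not (s := A) (fun a' => ω ∈ openConn a' a₀)
      rw [hA] at hsplit
      have hcut : (A.filter fun a' => ¬ ω ∈ openConn a' a₀) ⊆ T.filter fun v => ω ∉ openConn v a₀ := by
        intro x hx
        rw [Finset.mem_filter] at hx ⊢
        refine ⟨?_, hx.2⟩
        rw [hT, Finset.mem_erase, Finset.mem_erase]
        refine ⟨?_, ?_, hx.1⟩
        · rintro rfl; exact hx.2 hcc
        · rintro rfl; exact hx.2 (SimpleGraph.Reachable.refl _ : (openGraph ω).Reachable x x)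
      have hc := Finset.card_le_card hcut
      simp only [hK, mem_setOf_eq]
      omega
    · left; exact hcc
  -- `μ(K) ≤ min 1 ((256/243) M)` and Harris
  have hK1 : μ.real K ≤ min 1 (256 / 243 * M) :=
    le_min measureReal_le_one (threeOfFour_count p a₀ T hTcard M (fun v hv => hδle v (hTA hv)))
  have hHarris : μ.real ((openConn c a₀ : Set (BondConfig (Fin n))) ∩ K) ≤
      μ.real (openConn c a₀ : Set (BondConfig (Fin n))) * μ.real K :=
    Literature.Probability.LatticeModels.prodBernoulli_harris_upper_lower p (isUpperSet_openConn c a₀)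
      (isLowerSet_thresholdCut T a₀ 3) (hms _) (hms _)
  have hconn : μ.real (openConn c a₀ : Set (BondConfig (Fin n))) = 1 - δ c := by
    have := probReal_compl_eq_one_sub (μ := μ) (hms (openConn c a₀ : Set (BondConfig (Fin n))))
    simp only [hδ]; linarith
  have hδc : δ c ≤ M := hδle c hcA
  have hδc0 : 0 ≤ δ c := measureReal_nonneg
  have hK0 : 0 ≤ μ.real K := measureReal_nonneg
  have hk1 : min 1 (256 / 243 * M) ≤ (1 : ℝ) := min_le_left _ _
  calc μ.real {ω : BondConfig (Fin n) | ω ∈ openConn a a₀ → 2 * (A.filter fun a' => ω ∈ openConn a' a₀).card ≤ A.card}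
      ≤ μ.real ((openConn c a₀ : Set (BondConfig (Fin n)))ᶜ ∪ ((openConn c a₀ : Set (BondConfig (Fin n))) ∩ K)) :=
        measureReal_mono hsub
    _ ≤ μ.real (openConn c a₀ : Set (BondConfig (Fin n)))ᶜ + μ.real ((openConn c a₀ : Set (BondConfig (Fin n))) ∩ K) :=
        measureReal_union_le _ _
    _ ≤ δ c + (1 - δ c) * μ.real K := by rw [← hconn]; exact add_le_add le_rfl hHarris
    _ ≤ δ c + (1 - δ c) * min 1 (256 / 243 * M) :=
        add_le_add le_rfl (mul_le_mul_of_nonneg_left hK1 (by linarith [(measureReal_le_one : δ c ≤ 1)]))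
    _ ≤ M + (1 - M) * min 1 (256 / 243 * M) := by
        nlinarith [mul_nonneg (sub_nonneg.2 hδc) (sub_nonneg.2 hk1)]

/-- **MAJORITY GLUING AT `|A| = 6` WITH LOSS `δ₀ + (256/243)·δ₀·(1 − δ₀)`** for every weight function, observer, hub `a₀ ∈ A` and
`max_{a∈A} μ(a ↮ a₀) ≤ δ₀ ≤ 243/256` — strictly better than p315087's `(499/243)·δ₀` for every `δ₀ > 0` (van den Berg–Kahn + Harris + closure over
degenerate weights). [cite: VandenbergKahn2001, Thm 1.2 (p. 123)] [cite: KozmaNitzan2024, Conj. 1 (p. 3)] -/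
theorem majorityGluing_card_six_harris (w : Sym2 (Fin n) → unitInterval) (A : Finset (Fin n)) (o a₀ : Fin n) (δ₀ : ℝ)
    (ha₀ : a₀ ∈ A) (hA : A.card = 6) (hδ₀ : ∀ a ∈ A, (prodBernoulli w).real (openConn a a₀ : Set (BondConfig (Fin n)))ᶜ ≤ δ₀)
    (hδ₀' : δ₀ ≤ 243 / 256) :
    (prodBernoulli w).real (⋃ a ∈ A, openConn o a) -
        (prodBernoulli w).real {ω : BondConfig (Fin n) | ω ∈ openConn o a₀ ∧
          A.card < 2 * (A.filter fun a => ω ∈ openConn o a).card}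
      ≤ δ₀ + 256 / 243 * δ₀ * (1 - δ₀) := by
  set f : (Sym2 (Fin n) → unitInterval) → ℝ := fun p =>
    (prodBernoulli p).real (⋃ a ∈ A, openConn o a) -
        (prodBernoulli p).real {ω : BondConfig (Fin n) | ω ∈ openConn o a₀ ∧
          A.card < 2 * (A.filter fun a => ω ∈ openConn o a).card} with hf
  set Mf : (Sym2 (Fin n) → unitInterval) → ℝ := fun p =>
    A.sup' ⟨a₀, ha₀⟩ (fun a' => (prodBernoulli p).real (openConn a' a₀ : Set (BondConfig (Fin n)))ᶜ) with hMf
  set g : (Sym2 (Fin n) → unitInterval) → ℝ := fun p => Mf p + (1 - Mf p) * min 1 (256 / 243 * Mf p) with hg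
  have hfc : Continuous f := (prodBernoulli_real_continuous _).sub (prodBernoulli_real_continuous _)
  have hMc : Continuous Mf := Continuous.finset_sup'_apply _ fun a' _ => prodBernoulli_real_continuous _
  have hgc : Continuous g :=
    hMc.add ((continuous_const.sub hMc).mul (continuous_const.min (continuous_const.mul hMc)))
  have hfg : ∀ p : Sym2 (Fin n) → unitInterval, (∀ e, 0 < p e ∧ p e < 1) → f p ≤ g p := by
    intro p hp
    obtain ⟨a, haA, hle⟩ := deficit_le_hubEvent p hp A o a₀ ha₀
    exact hle.trans (hubEvent_card_six_harris p A a₀ a ha₀ haA hA)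
  have hw := weights_le_of_forall_pos_lt_one hfc hgc hfg w
  -- `g w ≤ δ₀ + (256/243) δ₀ (1 - δ₀)` by monotonicity on `[0, 243/256]`
  have hMw : Mf w ≤ δ₀ := Finset.sup'_le _ _ fun a' ha' => hδ₀ a' ha'
  have hMw0 : 0 ≤ Mf w := le_trans measureReal_nonneg (Finset.le_sup' (fun a' => (prodBernoulli w).real
    (openConn a' a₀ : Set (BondConfig (Fin n)))ᶜ) ha₀)
  have hmin : min 1 (256 / 243 * Mf w) = 256 / 243 * Mf w := min_eq_right (by nlinarith)
  have hgw : g w = Mf w + 256 / 243 * Mf w * (1 - Mf w) := by simp only [hg, hmin]; ring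
  have hmono : Mf w + 256 / 243 * Mf w * (1 - Mf w) ≤ δ₀ + 256 / 243 * δ₀ * (1 - δ₀) := by nlinarith
  calc f w ≤ g w := hw
    _ = Mf w + 256 / 243 * Mf w * (1 - Mf w) := hgw
    _ ≤ δ₀ + 256 / 243 * δ₀ * (1 - δ₀) := hmono

/-- **`C(6) = 2` OUTSIDE THE SMALL-MARGINAL REGIME:** at `|A| = 6`, for every weight function, observer, hub `a₀ ∈ A` and `δ₀ ≥ max_{a∈A} μ(a ↮ a₀)`
with `δ₀ ≥ 13/256` (`≈ 0.0508`):  `μ(o ↔ a₀ ∧ 2N > 6) ≥ μ(o ↔ A) − 2·δ₀`.  (`δ₀ ≤ 243/256`: the previous theorem and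
`(256/243)(1 − δ₀) ≤ 1`; larger `δ₀`: the deficit is `≤ 1 ≤ 2δ₀`.)  The loss `2·max` at `|A| = 6` thus remains open only for `max < 13/256`.
[cite: VandenbergKahn2001, Thm 1.2 (p. 123)] [cite: KozmaNitzan2024, Conj. 1 (p. 3)] -/
theorem majorityGluing_two_card_six_of_ge (w : Sym2 (Fin n) → unitInterval) (A : Finset (Fin n)) (o a₀ : Fin n) (δ₀ : ℝ)
    (ha₀ : a₀ ∈ A) (hA : A.card = 6) (hδ₀ : ∀ a ∈ A, (prodBernoulli w).real (openConn a a₀ : Set (BondConfig (Fin n)))ᶜ ≤ δ₀)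
    (h13 : 13 / 256 ≤ δ₀) :
    (prodBernoulli w).real (⋃ a ∈ A, openConn o a) - 2 * δ₀ ≤
      (prodBernoulli w).real {ω : BondConfig (Fin n) | ω ∈ openConn o a₀ ∧
          A.card < 2 * (A.filter fun a => ω ∈ openConn o a).card} := by
  by_cases hsmall : δ₀ ≤ 243 / 256
  · have h := majorityGluing_card_six_harris w A o a₀ δ₀ ha₀ hA hδ₀ hsmall
    have : δ₀ + 256 / 243 * δ₀ * (1 - δ₀) ≤ 2 * δ₀ := by nlinarith
    linarith
  · have h1 : (prodBernoulli w).real (⋃ a ∈ A, openConn o a) ≤ 1 := measureReal_le_one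
    have h0 : 0 ≤ (prodBernoulli w).real {ω : BondConfig (Fin n) | ω ∈ openConn o a₀ ∧
        A.card < 2 * (A.filter fun a => ω ∈ openConn o a).card} := measureReal_nonneg
    push Not at hsmall
    linarith

end HubOnly

end Summit.CriticalPhenomena.PercolationContinuityZ3.Theorems

end
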